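import Literature.MathematicalPhysics.QuantumFieldTheory.Balaban1983to89.B9Eq321LandauOrthogonalZd

/-!
# `Balaban1983to89.B9Eq321LandauMultiplierIffZd` — [Balaban1985RegularSpaces] (1.38) p. 82 ∕ [Balaban1985BackgroundPropagators] (3.20)–(3.21) p. 394:
# THE TREE's MULTIPLIER FORM OF THE LANDAU CONDITION IS **EQUIVALENT** TO PRINT's ORTHOGONALITY FORM — `IsLandau138 L m η Ω₀ Λs U₀ A` ⟺
# «`Σ_x τ((Δ^η_{U₀}λ)(x)·(𝟙_{Ω₀}D^{η*}_{U₀}A)(x)) = 0` for every `λ ∈ N(Q′(U₀))`» — at EVERY background of units, for a finite `Ω₀` and a finite-dimensional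
# fibre with a non-degenerate trace pairing `τ(ab)`; the direction ⇐ is finite-dimensional duality (`(ker Q′)^⊥ = range Q′ᵀ`), with NO inverse of [B9]
# (3.25) ∕ Thm 3.11 (the identification `B8Eq138Multiplier` makes modulo those inverses)

statement-level skeleton of published theorems with citation tags; proofs where landed; nothing here is a claim about the
Yang–Mills mass gap

`[Balaban1985RegularSpaces]` ("B8", CMP **99** (1985) 75–102) (1.38) p. 82 *«R(U₀)D^{η*}_{U₀}A = 0»*; `[Balaban1985BackgroundPropagators]` ("B9", CMP **99** (1985)
389–434) p. 394 (3.21) *«R = Δ^η_U N(Q′), N(Q′) = {λ : Q′λ = 0}»*, (3.19) p. 393, (3.24) p. 394, p. 391 *«X·Y = tr XY»*.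

CITATION HEADER (lean-in-tree rule).  Cell `pub-ymgap`, DAG node N06 = [B9], width seat `pub-ymgap-dag-n06-w4` (g0), W-SEAT-START-LIST § n06 ITEM 4 (the Landau binder at
curved `U₀`).  WHY: the B8 lineage states the Landau gauge condition in MULTIPLIER form (`B8Eq138LandauZd.IsLandau138`: «Δ^η_{U₀}↾Ω₀(D^{η*}_{U₀}A) = Q′(U₀)ᵀμ
on Ω₀», seat dag-n05-a) and records its identification with print's projection form as holding «modulo the (3.25)-inverses, i.e. [B9] Thm 3.11»
(`B8Eq138Multiplier`).  The companion file `B9Eq321LandauOrthogonalZd` (this seat) proves multiplier ⇒ orthogonality at every background.  THIS FILE proves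
the CONVERSE by finite-dimensional linear algebra, so that the two forms are EQUIVALENT at every background of units whenever `Ω₀` is finite and the fibre is
finite-dimensional with a non-degenerate trace pairing (`M_N(ℂ)` with `tr`): on `E = {f : ℤᵈ → 𝔸 supported in Ω₀}` with the symmetric non-degenerate
pairing `⟨f, g⟩ = Σ_{x∈Ω₀} τ(f(x)g(x))`, the multiplier transposes `𝟙_{Ω₀}·Q′(U₀)ᵀμ` form a subspace `W` whose orthogonal IS `N(Q′(U₀))` (the transpose
identity of the companion file + non-degeneracy), hence `N(Q′(U₀))^⊥ = W^⊥⊥ = W` (Mathlib `LinearMap.BilinForm.orthogonal_orthogonal`).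

WHAT IS DECLARED ∕ PROVED (kernel, 0 sorry; 4 plumbing `def`s + theorems; no `instance`, no `notation`).
* §1 linearity of the transposes in the multiplier: `qprimeT1_add ∕ _smul`, `QprimeT_add ∕ _smul`, `QT_add ∕ _smul` ((3.19), (3.24) bookkeeping).
* §2 `suppSubC s` (the complex subspace of functions supported in `s = Ω₀`; finite-dimensional for a finite-dimensional fibre), `trPair τ s` (`Σ_{x∈s} τ(f(x)g(x))` as a
  complex bilinear form), `pairE` (its restriction); `pairE_isSymm` (τ tracial), `pairE_nondegenerate` (τ non-degenerate: `(∀ b, τ(ab) = 0) → a = 0`).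
* §3 `multSub` (= `W`: the `g ∈ E` agreeing on `Ω₀` with some `Q′(U₀)ᵀμ`), `nullSub` (= `N(Q′(U₀))` in `E`); ★ `nullSub_eq_orthogonal_multSub` (`N = W^⊥`).
* §4 ★★ `isLandau138_of_orthogonal` (orthogonality form ⇒ multiplier form) and ★★★ `isLandau138_iff_orthogonal` (the EQUIVALENCE, every background of units).

HONEST SCOPE.  (i) Finite-dimensional linear algebra; no estimate; no inverse of [B9] is used or constructed.  (ii) The orthogonality form here is the
complex-BILINEAR one of the tracial pairing `τ(ab)` over all `𝔸`-valued `λ ∈ N(Q′(U₀))` (the currency in which the companion file's theorem holds at every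
background of units); at a unitary `U₀` on Hermitian data it is print's Hilbert-space statement (`B9Eq321LandauProjectionZd`).  (iii) `τ` is a parameter
(tracial + non-degenerate; print's `tr` on `M_N(ℂ)`).  (iv) Count-neutral; N05 ∕ N06 NOT discharged; one finite `𝕋⁴` programme at fixed `ε`, Bałaban as printed; R4
closes only the conditional finite-`𝕋⁴` rung `BalabanLadder.UV` — nothing continuum ∕ ℝ⁴ ∕ OS ∕ mass gap ∕ Clay.  Unit `pub-ymgap-dag-n06-w4` (g0), 2026-08-28.
-/

noncomputable section

namespace Literature.MathematicalPhysics.QuantumFieldTheory.Balaban1983to89.B9Eq321LandauMultiplierIffZd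

open B7Prop1Explicit B7Eq78Linearization
open B8Ineq132 (covDeriv covDerivFwd)
open B8Eq119TwistedAxial (bgT)
open B8Eq138LandauZd (covDivB covLap qprimeT1 QprimeT QT IsLandau138)
open Literature.MathematicalPhysics.QuantumLattice (blockMap)
open B9Eq321LandauOrthogonalZd (finsum_pair_QT finsum_pair_covLap_symm trace_mul_conjR finsum_trace_covLap_mul_covDivB_eq_zero_of_isLandau138)

-- `Site` alone could resolve to the torus sites of `Setup.lean`; re-export the `ℤ^d` sites of `B7Prop1Explicit`.
export B7Prop1Explicit (Site)

variable {d : ℕ} {𝔸 : Type*} [NormedRing 𝔸] [NormedAlgebra ℂ 𝔸] [CompleteSpace 𝔸]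

/-! ## §1  The multiplier transposes are linear in the multiplier -/

section Linear

variable (L : ℕ) (U₀ : Site d → Fin d → 𝔸ˣ)

/-- one transpose step is additive in `ν`. [cite: Balaban1985BackgroundPropagators, (3.19) p.393 (bookkeeping)] -/
theorem qprimeT1_add (j : ℕ) (ν ν' : Site d → 𝔸) : qprimeT1 L U₀ j (ν + ν') = qprimeT1 L U₀ j ν + qprimeT1 L U₀ j ν' := by
  funext x
  simp only [qprimeT1, Pi.add_apply, conjR_add, smul_add]

/-- one transpose step is `ℂ`-homogeneous in `ν`. [cite: Balaban1985BackgroundPropagators, (3.19) p.393 (bookkeeping)] -/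
theorem qprimeT1_smul (j : ℕ) (c : ℂ) (ν : Site d → 𝔸) : qprimeT1 L U₀ j (c • ν) = c • qprimeT1 L U₀ j ν := by
  funext x
  simp only [qprimeT1, Pi.smul_apply, conjR_smul, smul_comm c]

/-- `Q′_jᵀ` is additive. [cite: Balaban1985BackgroundPropagators, (3.19) p.393 (bookkeeping)] -/
theorem QprimeT_add : ∀ (j : ℕ) (ν ν' : Site d → 𝔸), QprimeT L U₀ j (ν + ν') = QprimeT L U₀ j ν + QprimeT L U₀ j ν' := by
  intro j
  induction j with
  | zero => intro ν ν'; rfl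
  | succ j ih =>
    intro ν ν'
    show QprimeT L U₀ j (qprimeT1 L U₀ j (ν + ν')) = QprimeT L U₀ j (qprimeT1 L U₀ j ν) + QprimeT L U₀ j (qprimeT1 L U₀ j ν')
    rw [qprimeT1_add, ih]

/-- `Q′_jᵀ` is `ℂ`-homogeneous. [cite: Balaban1985BackgroundPropagators, (3.19) p.393 (bookkeeping)] -/
theorem QprimeT_smul : ∀ (j : ℕ) (c : ℂ) (ν : Site d → 𝔸), QprimeT L U₀ j (c • ν) = c • QprimeT L U₀ j ν := by
  intro j
  induction j with
  | zero => intro c ν; rfl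
  | succ j ih =>
    intro c ν
    show QprimeT L U₀ j (qprimeT1 L U₀ j (c • ν)) = c • QprimeT L U₀ j (qprimeT1 L U₀ j ν)
    rw [qprimeT1_smul, ih]

/-- the level sum `Q′(U₀)ᵀμ` is additive in the multiplier. [cite: Balaban1985BackgroundPropagators, (3.24) p.394 (bookkeeping)] -/
theorem QT_add (m : ℕ) (Λs : ℕ → Set (Site d)) (μ μ' : ℕ → Site d → 𝔸) (x : Site d) :
    QT L m Λs U₀ (μ + μ') x = QT L m Λs U₀ μ x + QT L m Λs U₀ μ' x := by
  simp only [QT, ← Finset.sum_add_distrib]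
  refine Finset.sum_congr rfl fun j _ => ?_
  have hind : (Λs j).indicator ((μ + μ') j) = (Λs j).indicator (μ j) + (Λs j).indicator (μ' j) := by
    funext y
    by_cases hy : y ∈ Λs j
    · simp only [Set.indicator_of_mem hy, Pi.add_apply]
    · simp only [Set.indicator_of_notMem hy, Pi.add_apply, add_zero]
  rw [hind, QprimeT_add, Pi.add_apply]

/-- the level sum `Q′(U₀)ᵀμ` is `ℂ`-homogeneous in the multiplier. [cite: Balaban1985BackgroundPropagators, (3.24) p.394 (bookkeeping)] -/
theorem QT_smul (m : ℕ) (Λs : ℕ → Set (Site d)) (c : ℂ) (μ : ℕ → Site d → 𝔸) (x : Site d) :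
    QT L m Λs U₀ (c • μ) x = c • QT L m Λs U₀ μ x := by
  simp only [QT, Finset.smul_sum]
  refine Finset.sum_congr rfl fun j _ => ?_
  have hind : (Λs j).indicator ((c • μ) j) = c • (Λs j).indicator (μ j) := by
    funext y
    by_cases hy : y ∈ Λs j
    · simp only [Set.indicator_of_mem hy, Pi.smul_apply]
    · simp only [Set.indicator_of_notMem hy, Pi.smul_apply, smul_zero]
  rw [hind, QprimeT_smul, Pi.smul_apply]

end Linear

/-! ## §2  The complex pairing space: functions supported in `Ω₀`, `⟨f, g⟩ = Σ_{x∈Ω₀} τ(f(x)g(x))` -/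

section Space

variable (τ : 𝔸 →ₗ[ℂ] ℂ) (s : Finset (Site d))

/-- functions `ℤᵈ → 𝔸` supported in the finite `s = Ω₀`, as a COMPLEX subspace. [cite: Balaban1985BackgroundPropagators, (3.21) p.394 («L²(Ω₀, 𝔤)»)] -/
def suppSubC : Submodule ℂ (Site d → 𝔸) where
  carrier := {f | ∀ x, x ∉ s → f x = 0}
  add_mem' := by
    intro f g hf hg x hx
    rw [Pi.add_apply, hf x hx, hg x hx, add_zero]
  zero_mem' := fun _ _ => rfl
  smul_mem' := by
    intro c f hf x hx
    rw [Pi.smul_apply, hf x hx, smul_zero]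

omit [CompleteSpace 𝔸] in
/-- restriction to `s` is injective on `suppSubC s`, so it is finite-dimensional over `ℂ` when the fibre is. [folklore] -/
private theorem finiteDimensional_suppSubC [FiniteDimensional ℂ 𝔸] : FiniteDimensional ℂ (suppSubC (𝔸 := 𝔸) s) := by
  let res : (suppSubC (𝔸 := 𝔸) s) →ₗ[ℂ] ((↥s) → 𝔸) :=
    { toFun := fun f x => (f : Site d → 𝔸) x
      map_add' := fun f g => rfl
      map_smul' := fun c f => rfl }
  refine FiniteDimensional.of_injective res fun f g h => ?_
  apply Subtype.ext
  funext x
  by_cases hx : x ∈ s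
  · exact congr_fun h ⟨x, hx⟩
  · rw [f.2 x hx, g.2 x hx]

/-- **THE TRACIAL PAIRING `Σ_{x∈Ω₀} τ(f(x)g(x))`** as a complex bilinear form on all functions (print's «⟨λ, λ′⟩ = Σ η^d tr λ(x)λ′(x)», the positive weight dropped).
[cite: Balaban1985BackgroundPropagators, (3.17) p.393, p.391 («X·Y = tr XY»)] -/
def trPair : LinearMap.BilinForm ℂ (Site d → 𝔸) :=
  LinearMap.mk₂ ℂ (fun f g => ∑ x ∈ s, τ (f x * g x))
    (fun f₁ f₂ g => by
      rw [← Finset.sum_add_distrib]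
      exact Finset.sum_congr rfl fun x _ => by rw [Pi.add_apply, add_mul, map_add])
    (fun c f g => by
      rw [Finset.smul_sum]
      exact Finset.sum_congr rfl fun x _ => by rw [Pi.smul_apply, smul_mul_assoc, map_smul])
    (fun f g₁ g₂ => by
      rw [← Finset.sum_add_distrib]
      exact Finset.sum_congr rfl fun x _ => by rw [Pi.add_apply, mul_add, map_add])
    (fun c f g => by
      rw [Finset.smul_sum]
      exact Finset.sum_congr rfl fun x _ => by rw [Pi.smul_apply, mul_smul_comm, map_smul])

omit [CompleteSpace 𝔸] in
/-- the pairing unfolded. [cite: Balaban1985BackgroundPropagators, (3.17) p.393 (bookkeeping)] -/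
theorem trPair_apply (f g : Site d → 𝔸) : trPair τ s f g = ∑ x ∈ s, τ (f x * g x) := rfl

/-- the pairing on the supported functions. [cite: Balaban1985BackgroundPropagators, (3.21) p.394 (bookkeeping)] -/
def pairE : LinearMap.BilinForm ℂ (suppSubC (𝔸 := 𝔸) s) := (trPair τ s).restrict (suppSubC s)

omit [CompleteSpace 𝔸] in
/-- the restricted pairing unfolded. [cite: Balaban1985BackgroundPropagators, (3.21) p.394 (bookkeeping)] -/
theorem pairE_apply (f g : suppSubC (𝔸 := 𝔸) s) : pairE τ s f g = ∑ x ∈ s, τ ((f : Site d → 𝔸) x * (g : Site d → 𝔸) x) := rfl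

omit [CompleteSpace 𝔸] in
/-- **SYMMETRY** for a tracial `τ`. [cite: Balaban1985BackgroundPropagators, p.391 (tr XY = tr YX)] -/
theorem pairE_isSymm (hτt : ∀ a b : 𝔸, τ (a * b) = τ (b * a)) : (pairE τ s).IsSymm :=
  ⟨fun f g => by
    rw [pairE_apply, pairE_apply]
    exact Finset.sum_congr rfl fun x _ => hτt _ _⟩

omit [CompleteSpace 𝔸] in
/-- **NON-DEGENERACY** for a non-degenerate trace pairing (`(∀ b, τ(ab) = 0) → a = 0`; print's `tr` on `M_N(ℂ)`): testing against one-site functions.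
[cite: Balaban1985BackgroundPropagators, (3.21) p.394 («the Hilbert space L²(Ω₀, 𝔤)»)] -/
theorem pairE_nondegenerate (hτt : ∀ a b : 𝔸, τ (a * b) = τ (b * a)) (hτn : ∀ a : 𝔸, (∀ b : 𝔸, τ (a * b) = 0) → a = 0) :
    (pairE τ s).Nondegenerate := by
  classical
  -- left separation; right separation follows by symmetry
  have hleft : ∀ f : suppSubC (𝔸 := 𝔸) s, (∀ g, pairE τ s f g = 0) → f = 0 := by
    intro f hf
    apply Subtype.ext
    funext x
    by_cases hx : x ∈ s
    · refine hτn _ fun b => ?_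
      -- test against `δ_x · b`
      have hmem : (Pi.single x b : Site d → 𝔸) ∈ suppSubC (𝔸 := 𝔸) s :=
        fun y hy => Pi.single_eq_of_ne (by rintro rfl; exact hy hx) _
      have h := hf ⟨Pi.single x b, hmem⟩
      rw [pairE_apply, Finset.sum_eq_single x (fun y _ hyx => by
        show τ ((f : Site d → 𝔸) y * (Pi.single x b : Site d → 𝔸) y) = 0
        rw [Pi.single_eq_of_ne hyx, mul_zero, map_zero]) (fun h' => absurd hx h')] at h
      simpa using h
    · exact f.2 x hx
  refine ⟨hleft, fun g hg => hleft g fun f => ?_⟩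
  rw [(pairE_isSymm τ s hτt).eq g f]
  exact hg f

end Space

/-! ## §3  `W = {𝟙_{Ω₀}Q′(U₀)ᵀμ}` and `N(Q′(U₀))`; `N = W^⊥` -/

section Subspaces

variable (τ : 𝔸 →ₗ[ℂ] ℂ) (s : Finset (Site d)) (L m : ℕ) [NeZero L] (Λs : ℕ → Set (Site d)) (U₀ : Site d → Fin d → 𝔸ˣ)

/-- **`W`**: the supported functions that agree on `Ω₀` with some multiplier transpose `Q′(U₀)ᵀμ` — the right-hand sides of (1.38)'s record form.
[cite: Balaban1985BackgroundPropagators, (3.24) p.394; Balaban1985RegularSpaces, (1.38) p.82] -/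
def multSub : Submodule ℂ (suppSubC (𝔸 := 𝔸) s) where
  carrier := {g | ∃ μ : ℕ → Site d → 𝔸, ∀ x ∈ s, (g : Site d → 𝔸) x = QT L m Λs U₀ μ x}
  add_mem' := by
    rintro g g' ⟨μ, hμ⟩ ⟨μ', hμ'⟩
    refine ⟨μ + μ', fun x hx => ?_⟩
    rw [Submodule.coe_add, Pi.add_apply, hμ x hx, hμ' x hx, QT_add]
  zero_mem' := ⟨fun _ _ => 0, fun x _ => by
    rw [Submodule.coe_zero, Pi.zero_apply, B8Eq138LandauZd.QT_zero]⟩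
  smul_mem' := by
    rintro c g ⟨μ, hμ⟩
    refine ⟨c • μ, fun x hx => ?_⟩
    rw [Submodule.coe_smul, Pi.smul_apply, hμ x hx, QT_smul]

/-- **`N(Q′(U₀))`** in the supported functions: `Q′_j(U₀)λ = 0` on `Λs j`, `j ≤ m` («N(Q′) = {λ : Q′λ = 0}», (3.21)). [cite: Balaban1985BackgroundPropagators, (3.21) p.394, (3.19) p.393] -/
def nullSub : Submodule ℂ (suppSubC (𝔸 := 𝔸) s) where
  carrier := {lam | ∀ j, j ≤ m → ∀ y ∈ Λs j, QprimeIter (zdBlocking d L) (bgT L U₀) j (lam : Site d → 𝔸) y = 0}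
  add_mem' := by
    intro f g hf hg j hj y hy
    rw [Submodule.coe_add]
    have h := congr_fun (QprimeIter_add (zdBlocking d L) (bgT L U₀) (f : Site d → 𝔸) (g : Site d → 𝔸) j) y
    rw [show ((f : Site d → 𝔸) + (g : Site d → 𝔸)) = fun x => (f : Site d → 𝔸) x + (g : Site d → 𝔸) x from rfl, h,
      hf j hj y hy, hg j hj y hy, add_zero]
  zero_mem' := fun j _ y _ => by
    rw [Submodule.coe_zero]
    exact B8Eq138LandauZd.QprimeIter_zero_fun L U₀ j y
  smul_mem' := by
    intro c f hf j hj y hy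
    rw [Submodule.coe_smul]
    have h := congr_fun (QprimeIter_smul (zdBlocking d L) (bgT L U₀) c (f : Site d → 𝔸) j) y
    rw [show (c • (f : Site d → 𝔸)) = fun x => c • (f : Site d → 𝔸) x from rfl, h, hf j hj y hy, smul_zero]

variable {τ s L m Λs U₀}

/-- the tracial pairing of a supported `λ` against `Q′ᵀμ` transposes onto `Q′_jλ` against the multiplier, level by level (the companion file's `finsum_pair_QT`
for the all-units pairing `τ(ab)`). [cite: Balaban1985BackgroundPropagators, (3.19) p.393, (3.24) p.394] -/
theorem sum_trace_mul_QT (hτt : ∀ a b : 𝔸, τ (a * b) = τ (b * a)) (lam : suppSubC (𝔸 := 𝔸) s) (μ : ℕ → Site d → 𝔸) :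
    ∑ x ∈ s, τ ((lam : Site d → 𝔸) x * QT L m Λs U₀ μ x) =
      ∑ j ∈ Finset.range (m + 1), ∑ᶠ y, τ (QprimeIter (zdBlocking d L) (bgT L U₀) j (lam : Site d → 𝔸) y * (Λs j).indicator (μ j) y) := by
  have hlam : (Function.support (lam : Site d → 𝔸)).Finite :=
    s.finite_toSet.subset fun x hx => by
      by_contra h'
      exact hx (lam.2 x fun h => h' h)
  have hsupp : (Function.support fun x => τ ((lam : Site d → 𝔸) x * QT L m Λs U₀ μ x)) ⊆ ↑s := by
    intro x hx
    rw [Function.mem_support] at hx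
    by_contra hxs
    exact hx (by rw [lam.2 x fun h => hxs h, zero_mul, map_zero])
  have key := finsum_pair_QT ((LinearMap.mul ℝ 𝔸).compr₂ (τ.restrictScalars ℝ)) ⊤ L U₀
    (fun u _ a b => by simpa using trace_mul_conjR τ hτt u a b) (fun _ _ _ => Subgroup.mem_top _) hlam m Λs μ
  rw [← finsum_eq_sum_of_support_subset _ hsupp]
  simpa using key

/-- ★ **`N(Q′(U₀)) = W^⊥`**: a supported `λ` is orthogonal to every `Q′(U₀)ᵀμ` iff `Q′_j(U₀)λ = 0` on the `Λ_j` (⇐ by the transpose identity; ⇒ by testing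
against the multiplier supported at one `(j, y)` and the non-degeneracy of `τ`). [cite: Balaban1985BackgroundPropagators, (3.21) p.394, (3.19) p.393, (3.24) p.394] -/
theorem nullSub_eq_orthogonal_multSub (hτt : ∀ a b : 𝔸, τ (a * b) = τ (b * a)) (hτn : ∀ a : 𝔸, (∀ b : 𝔸, τ (a * b) = 0) → a = 0) :
    nullSub s L m Λs U₀ = (pairE τ s).orthogonal (multSub s L m Λs U₀) := by
  classical
  ext lam
  rw [LinearMap.BilinForm.mem_orthogonal_iff]
  constructor
  · -- `λ ∈ N` ⊥ every `Q′ᵀμ`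
    rintro hlam g ⟨μ, hμ⟩
    rw [(pairE_isSymm τ s hτt).eq g lam, pairE_apply]
    have h1 : ∑ x ∈ s, τ ((lam : Site d → 𝔸) x * (g : Site d → 𝔸) x) = ∑ x ∈ s, τ ((lam : Site d → 𝔸) x * QT L m Λs U₀ μ x) :=
      Finset.sum_congr rfl fun x hx => by rw [hμ x hx]
    rw [h1, sum_trace_mul_QT hτt lam μ]
    refine Finset.sum_eq_zero fun j hj => ?_
    have hjm : j ≤ m := Nat.lt_succ_iff.1 (Finset.mem_range.1 hj)
    have h0 : ∀ y, τ (QprimeIter (zdBlocking d L) (bgT L U₀) j (lam : Site d → 𝔸) y * (Λs j).indicator (μ j) y) = 0 := by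
      intro y
      by_cases hy : y ∈ Λs j
      · rw [hlam j hjm y hy, zero_mul, map_zero]
      · rw [Set.indicator_of_notMem hy, mul_zero, map_zero]
    rw [finsum_congr h0, finsum_zero]
  · -- ⊥ every `Q′ᵀμ` ⇒ `Q′_jλ = 0` on `Λ_j`: test the multiplier `δ_{(j,y₀)}·b`
    intro h j hj y₀ hy₀
    refine hτn _ fun b => ?_
    let μ : ℕ → Site d → 𝔸 := fun j' y => if j' = j then (Pi.single y₀ b : Site d → 𝔸) y else 0
    -- the supported function `𝟙_s · Q′ᵀμ`
    have hmem : (↑s : Set (Site d)).indicator (QT L m Λs U₀ μ) ∈ suppSubC (𝔸 := 𝔸) s :=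
      fun x hx => Set.indicator_of_notMem (fun h' => hx (Finset.mem_coe.1 h')) _
    have hg : (⟨_, hmem⟩ : suppSubC (𝔸 := 𝔸) s) ∈ multSub s L m Λs U₀ :=
      ⟨μ, fun x hx => Set.indicator_of_mem (Finset.mem_coe.2 hx) _⟩
    have h1 := h _ hg
    rw [(pairE_isSymm τ s hτt).eq _ lam, pairE_apply] at h1
    have h2 : ∑ x ∈ s, τ ((lam : Site d → 𝔸) x * (↑s : Set (Site d)).indicator (QT L m Λs U₀ μ) x) =
        ∑ x ∈ s, τ ((lam : Site d → 𝔸) x * QT L m Λs U₀ μ x) :=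
      Finset.sum_congr rfl fun x hx => by rw [Set.indicator_of_mem (Finset.mem_coe.2 hx)]
    rw [h2, sum_trace_mul_QT hτt lam μ] at h1
    -- only the level `j` and the site `y₀` survive
    rw [Finset.sum_eq_single j (fun j' _ hj' => by
        have : (Λs j').indicator (μ j') = 0 := by
          funext y
          by_cases hy : y ∈ Λs j'
          · simp only [μ, Set.indicator_of_mem hy, if_neg hj', Pi.zero_apply]
          · simp only [Set.indicator_of_notMem hy, Pi.zero_apply]
        simp only [this, Pi.zero_apply, mul_zero, map_zero, finsum_zero])
      (fun hj' => absurd (Finset.mem_range.2 (Nat.lt_succ_of_le hj)) hj')] at h1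
    have h3 : ∀ y, τ (QprimeIter (zdBlocking d L) (bgT L U₀) j (lam : Site d → 𝔸) y * (Λs j).indicator (μ j) y) =
        if y = y₀ then τ (QprimeIter (zdBlocking d L) (bgT L U₀) j (lam : Site d → 𝔸) y₀ * b) else 0 := by
      intro y
      by_cases hy : y = y₀
      · subst hy
        rw [if_pos rfl, Set.indicator_of_mem hy₀]
        simp only [μ, if_pos rfl, Pi.single_eq_same]
      · rw [if_neg hy]
        by_cases hy' : y ∈ Λs j
        · rw [Set.indicator_of_mem hy']
          simp only [μ, if_pos rfl, Pi.single_eq_of_ne hy, mul_zero, map_zero]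
        · rw [Set.indicator_of_notMem hy', mul_zero, map_zero]
    rw [finsum_congr h3, finsum_eq_single _ y₀ (fun y hy => if_neg hy), if_pos rfl] at h1
    exact h1

end Subspaces

/-! ## §4  Orthogonality form ⇒ multiplier form, and the equivalence -/

section Iff

variable {τ : 𝔸 →ₗ[ℂ] ℂ} {s : Finset (Site d)} {L m : ℕ} [NeZero L] {η : ℝ} {Λs : ℕ → Set (Site d)} {U₀ : Site d → Fin d → 𝔸ˣ}

/-- ★★ **ORTHOGONALITY FORM ⇒ MULTIPLIER FORM** at every background of units (finite `Ω₀ = s`, finite-dimensional fibre, `τ` tracial and non-degenerate): if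
`Σᶠ_x τ((Δ^η_{U₀}λ)(x)·(𝟙_{Ω₀}D^{η*}_{U₀}A)(x)) = 0` for every `λ` supported in `Ω₀` with `Q′_j(U₀)λ = 0` on `Λ_j` (`j ≤ m`), then `Δ^η_{U₀}(𝟙_{Ω₀}D^{η*}_{U₀}A) =
Q′(U₀)ᵀμ` on `Ω₀` for some multiplier `μ` (`IsLandau138`).  Proof: `g = 𝟙_{Ω₀}Δ^η_{U₀}(𝟙_{Ω₀}D^{η*}_{U₀}A) ∈ N^⊥` (by the symmetry of `Δ^η_{U₀}`), and
`N^⊥ = W^⊥⊥ = W` by §3 and finite-dimensional duality. [cite: Balaban1985RegularSpaces, (1.38) p.82; Balaban1985BackgroundPropagators, (3.20)–(3.21) p.394, (3.23)–(3.24) p.394] -/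
theorem isLandau138_of_orthogonal [FiniteDimensional ℂ 𝔸] (hτt : ∀ a b : 𝔸, τ (a * b) = τ (b * a))
    (hτn : ∀ a : 𝔸, (∀ b : 𝔸, τ (a * b) = 0) → a = 0) {A : Site d → Fin d → 𝔸}
    (h : ∀ lam : Site d → 𝔸, (∀ x, x ∉ (↑s : Set (Site d)) → lam x = 0) →
      (∀ j, j ≤ m → ∀ y ∈ Λs j, QprimeIter (zdBlocking d L) (bgT L U₀) j lam y = 0) →
      ∑ᶠ x, τ (covLap η U₀ lam x * (↑s : Set (Site d)).indicator (covDivB η U₀ A) x) = 0) :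
    IsLandau138 L m η (↑s : Set (Site d)) Λs U₀ A := by
  classical
  haveI := finiteDimensional_suppSubC (𝔸 := 𝔸) s
  set φ : Site d → 𝔸 := (↑s : Set (Site d)).indicator (covDivB η U₀ A) with hφ
  -- the candidate `g = 𝟙_s Δ(φ)`
  have hgmem : (↑s : Set (Site d)).indicator (covLap η U₀ φ) ∈ suppSubC (𝔸 := 𝔸) s :=
    fun x hx => Set.indicator_of_notMem (fun h' => hx (Finset.mem_coe.1 h')) _
  set g : suppSubC (𝔸 := 𝔸) s := ⟨_, hgmem⟩ with hg
  -- `g ∈ N^⊥`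
  have hgorth : g ∈ (pairE τ s).orthogonal (nullSub s L m Λs U₀) := by
    rw [LinearMap.BilinForm.mem_orthogonal_iff]
    intro lam hlam
    rw [pairE_apply]
    have hsupp : ∀ x, x ∉ (↑s : Set (Site d)) → (lam : Site d → 𝔸) x = 0 := fun x hx => lam.2 x fun h' => hx (Finset.mem_coe.2 h')
    have hlamf : (Function.support (lam : Site d → 𝔸)).Finite :=
      s.finite_toSet.subset fun x hx => by by_contra h'; exact hx (hsupp x h')
    have hφf : (Function.support φ).Finite := s.finite_toSet.subset Set.support_indicator_subset
    -- `Σ_{x∈s} τ(λ · 𝟙_sΔφ) = Σᶠ τ(λ · Δφ) = Σᶠ τ(Δλ · φ) = 0`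
    have h1 : ∑ x ∈ s, τ ((lam : Site d → 𝔸) x * (g : Site d → 𝔸) x) = ∑ᶠ x, τ ((lam : Site d → 𝔸) x * covLap η U₀ φ x) := by
      rw [finsum_eq_sum_of_support_subset _ (s := s) ?_]
      · refine Finset.sum_congr rfl fun x hx => ?_
        show τ ((lam : Site d → 𝔸) x * (↑s : Set (Site d)).indicator (covLap η U₀ φ) x) = _
        rw [Set.indicator_of_mem (Finset.mem_coe.2 hx)]
      · intro x hx
        rw [Function.mem_support] at hx
        by_contra hxs
        exact hx (by rw [hsupp x hxs, zero_mul, map_zero])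
    have key := finsum_pair_covLap_symm ((LinearMap.mul ℝ 𝔸).compr₂ (τ.restrictScalars ℝ)) ⊤ η U₀
      (fun u _ a b => by simpa using trace_mul_conjR τ hτt u a b) (fun _ _ => Subgroup.mem_top _) hφf hlamf
    have key' : ∑ᶠ x, τ ((lam : Site d → 𝔸) x * covLap η U₀ φ x) = ∑ᶠ x, τ (covLap η U₀ (lam : Site d → 𝔸) x * φ x) := by
      simpa using key
    rw [h1, key']
    exact h _ hsupp hlam
  -- `N^⊥ = W^⊥⊥ = W`
  rw [nullSub_eq_orthogonal_multSub (τ := τ) hτt hτn,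
    LinearMap.BilinForm.orthogonal_orthogonal (pairE_nondegenerate τ s hτt hτn) (pairE_isSymm τ s hτt).isRefl] at hgorth
  obtain ⟨μ, hμ⟩ := hgorth
  refine ⟨μ, fun x hx => ?_⟩
  have hx' : x ∈ s := Finset.mem_coe.1 hx
  have := hμ x hx'
  rw [show (g : Site d → 𝔸) x = covLap η U₀ φ x from Set.indicator_of_mem hx _] at this
  exact this

/-- ★★★ **THE MULTIPLIER FORM (1.38) OF RECORD IS EQUIVALENT TO PRINT's ORTHOGONALITY FORM (3.21)** at EVERY background of units `U₀` (finite `Ω₀`, fibre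
finite-dimensional with a tracial non-degenerate `τ`): `IsLandau138 L m η Ω₀ Λs U₀ A` ⟺ `D^{η*}_{U₀}A ⊥_{τ} Δ^η_{U₀}N(Q′(U₀))` — «R(U₀)D^{η*}_{U₀}A = 0» with NO
(3.25)-inverse ∕ Thm 3.11 in the identification. [cite: Balaban1985RegularSpaces, (1.38) p.82, (1.42) p.83; Balaban1985BackgroundPropagators, (3.20)–(3.21) p.394, (3.25) p.394] -/
theorem isLandau138_iff_orthogonal [FiniteDimensional ℂ 𝔸] (hτt : ∀ a b : 𝔸, τ (a * b) = τ (b * a))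
    (hτn : ∀ a : 𝔸, (∀ b : 𝔸, τ (a * b) = 0) → a = 0) (A : Site d → Fin d → 𝔸) :
    IsLandau138 L m η (↑s : Set (Site d)) Λs U₀ A ↔
      ∀ lam : Site d → 𝔸, (∀ x, x ∉ (↑s : Set (Site d)) → lam x = 0) →
        (∀ j, j ≤ m → ∀ y ∈ Λs j, QprimeIter (zdBlocking d L) (bgT L U₀) j lam y = 0) →
        ∑ᶠ x, τ (covLap η U₀ lam x * (↑s : Set (Site d)).indicator (covDivB η U₀ A) x) = 0 :=
  ⟨fun h _ hsupp hQ => finsum_trace_covLap_mul_covDivB_eq_zero_of_isLandau138 τ hτt s.finite_toSet h hsupp hQ,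
    isLandau138_of_orthogonal hτt hτn⟩

end Iff

end Literature.MathematicalPhysics.QuantumFieldTheory.Balaban1983to89.B9Eq321LandauMultiplierIffZd

end
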